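import Summits.HubbardSuperconductivity.HubbardSuperconductivity.Theorems.InfiniteVolumeFirstCoarseTightnessBlockPairGram
import Summits.HubbardSuperconductivity.HubbardSuperconductivity.Theorems.InfiniteVolumeFirstCoarseTightnessBlockPairOperator

/-!
# The block pair Gram bound: `‖B_a ψ‖² ≤ 64 R² + 8 κ₀² (Σ_j x_j + (Σ_j (x_j(1-x_j))^{1/4})²)`

Support for the cruxes `NoInfraredPileUp` (stmt-HubbardSuperconductivity-18534) and
`NoNormalLimitState` (stmt-HubbardSuperconductivity-18533) of route `InfiniteVolumeFirst`: steps
S3+S4 of the coarse-tightness / atom-ceiling programme (`PLAN-coarse-tightness.md` attached to the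
item) — the LOCAL (block) version of the pair Gram bounds of
`Literature/MathematicalPhysics/QuantumLattice/FreeFermiGasPairGramBounds.lean`, feeding the
mesoscopic pair-order ceiling `(L²R⁴)⁻¹ Σ_a ‖B_a ψ‖²` of weak-coupling Hubbard ground states.

This file (4/4) assembles files 1–3: with the inner `d`-wave kernel diagonal in a real orthonormal
block family, `K_d = Σ_j κ_j φ_j φ_jᵀ`, `|κ_j| ≤ κ₀` (the product sine basis, `κ₀ = 2√2`, is step S2
of the programme, elsewhere), the block pair operator is `B_a = 2 Σ_j κ_j c_↑(φ_j)c_↓(φ_j) + ∂_a` with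
`‖∂_a ψ‖ ≤ 4√2 R`, whence for every unit `ψ`:
`‖B_a ψ‖² ≤ 64 R² + 8 κ₀² (Σ_j x_j + (Σ_j (x_j (1 - x_j))^{1/4})²)`, `x_j = ⟨n_↑(φ_j)⟩`
(`blockPairGram_bound`; registered stub `stub_coarseBlockPairGramBound` with `J = [0,R)²`).
Downstream (steps S5–S11): the block kinetic budget bounds `Σ_j |ε_j - μ| x_j(1-x_j)` on average over
the translates `a`, the uniform `√`-shell count bounds `Σ_j (x_j(1-x_j))^{1/4}`, and the average of
`‖B_a ψ‖²/R⁴` is the mesoscopic pair order controlling both the window sums of `NoInfraredPileUp` and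
the condensate atoms of `NoNormalLimitState`.

Sources: J. Bardeen, L. N. Cooper, J. R. Schrieffer, Phys. Rev. 108 (1957) 1175, §II;
C. N. Yang, Rev. Mod. Phys. 34 (1962) 694, §3; O. Bratteli, D. W. Robinson, *Operator Algebras and
Quantum Statistical Mechanics II* §5.2.2 (`a(f)`); D. J. Scalapino, Phys. Rep. 250 (1995) 329, §2.
Folklore finite-dimensional statements; no definition and no named fact is introduced.
-/


noncomputable section

-- the mandated namespace `Summit.<Summit>.<Problem>.Theorems` repeats `HubbardSuperconductivity`
-- (single-problem summit, D-0017), which the `dupNamespace` linter flags on every declaration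
set_option linter.dupNamespace false

namespace Summit.HubbardSuperconductivity.HubbardSuperconductivity.Theorems.CoarseTightness

open Literature.MathematicalPhysics.QuantumLattice Literature.Probability.LatticeModels Matrix Finset
open Literature.MathematicalPhysics.QuantumLattice.RayleighBound
open scoped ComplexConjugate ComplexOrder

/-! ### The block pair Gram bound on the fermionic torus -/

section Torus

open Classical

variable {L : ℕ} [NeZero L]

/-! ### The block pair Gram bound -/

omit [NeZero L] in
/-- `(2x + y)² ≤ 8x² + 2y²`. [folklore] -/
theorem sq_two_mul_add_le (x y : ℝ) : (2 * x + y) ^ 2 ≤ 8 * x ^ 2 + 2 * y ^ 2 := by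
  nlinarith [sq_nonneg (2 * x - y)]

omit [NeZero L] in
/-- `‖z + z + b‖² ≤ 8A + 2B²` from `‖z‖² ≤ A` and `‖b‖ ≤ B`. [folklore] -/
theorem norm_self_add_self_add_sq_le {E : Type*} [SeminormedAddCommGroup E] (z b : E) {A B : ℝ}
    (hz : ‖z‖ ^ 2 ≤ A) (hb : ‖b‖ ≤ B) : ‖z + z + b‖ ^ 2 ≤ 8 * A + 2 * B ^ 2 := by
  have h1 : ‖z + z + b‖ ≤ 2 * ‖z‖ + ‖b‖ := by
    rw [two_mul]
    exact (norm_add_le _ _).trans (add_le_add (norm_add_le _ _) le_rfl)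
  have h2 : ‖z + z + b‖ ^ 2 ≤ (2 * ‖z‖ + ‖b‖) ^ 2 := pow_le_pow_left₀ (norm_nonneg _) h1 2
  have h3 : ‖b‖ ^ 2 ≤ B ^ 2 := pow_le_pow_left₀ (norm_nonneg _) hb 2
  nlinarith [sq_two_mul_add_le ‖z‖ ‖b‖]

/-- **Block pair Gram bound.** On the fermionic torus `(ℤ/Lℤ)²`, for a block corner `a`, a block
side `R ≤ L`, a real family `φ : J → [0,R)² → ℝ` with orthonormal rows in which the inner `d`-wave
kernel `K_d(u,v) = Σ_e [v = u + e] g_d(e)/√2` is diagonal, `K_d = Σ_j κ_j φ_j φ_jᵀ` with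
`|κ_j| ≤ κ₀`, and every unit vector `ψ`:
`‖B_a ψ‖² ≤ 64 R² + 8 κ₀² (Σ_j x_j + (Σ_j (x_j(1 - x_j))^{1/4})²)`,
where `B_a = Σ_{u ∈ [0,R)²} P_{a+u}` is the block pair operator of `tightnessExchange_boxSum_eq`
and `x_j = ⟨ψ, n_↑(φ_j) ψ⟩` is the occupation of the `↑` block mode `φ_j`
(`B_a = 2 Σ_j κ_j c_↑(φ_j)c_↓(φ_j) + ∂_a`, `‖∂_a ψ‖ ≤ 4√2 R`, abstract Gram bound for the pair sum).
Step S3+S4 of the coarse-tightness programme for `NoInfraredPileUp` / `NoNormalLimitState`.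
Bardeen–Cooper–Schrieffer (1957) §II; Yang (1962) §3. [folklore] -/
theorem blockPairGram_bound (a : TorusSite 2 L) {R : ℕ} (hRL : R ≤ L) {J : Type*} [Fintype J]
    [DecidableEq J] (φ : J → (Fin 2 → Fin R) → ℝ)
    (hON : ∀ j j', ∑ u, φ j u * φ j' u = if j = j' then 1 else 0) (κ : J → ℝ) (κ₀ : ℝ)
    (hκ : ∀ j, |κ j| ≤ κ₀)
    (hK : ∀ u v : Fin 2 → Fin R, (∑ e ∈ insert (0 : Site 2) unitSteps,
        if (∀ i, ((v i : ℕ) : ℤ) = ((u i : ℕ) : ℤ) + e i) then dWaveFormFactor e / Real.sqrt 2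
        else 0) = ∑ j, κ j * (φ j u * φ j v))
    (ψ : Fock (Orb (FermionTorus 2 L))) (hψ : star ψ ⬝ᵥ ψ = 1) :
    (star ((∑ u : Fin 2 → Fin R, localPair dWaveFormFactor L (a + fun i => ((u i : ℕ) : ZMod L))) *ᵥ ψ) ⬝ᵥ
        ((∑ u : Fin 2 → Fin R, localPair dWaveFormFactor L (a + fun i => ((u i : ℕ) : ZMod L))) *ᵥ ψ)).re ≤
      64 * (R : ℝ) ^ 2 + 8 * κ₀ ^ 2 *
        ((∑ j, (star ψ ⬝ᵥ (numberMode (Function.extend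
            (fun u : Fin 2 → Fin R =>
              orb (FermionTorus.ofTorusSite (a + fun i => ((u i : ℕ) : ZMod L))) 0)
            (fun u => ((φ j u : ℝ) : ℂ)) 0) *ᵥ ψ)).re) +
          (∑ j, Real.sqrt (Real.sqrt
            ((star ψ ⬝ᵥ (numberMode (Function.extend
                (fun u : Fin 2 → Fin R =>
                  orb (FermionTorus.ofTorusSite (a + fun i => ((u i : ℕ) : ZMod L))) 0)
                (fun u => ((φ j u : ℝ) : ℂ)) 0) *ᵥ ψ)).re *
              (1 - (star ψ ⬝ᵥ (numberMode (Function.extend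
                (fun u : Fin 2 → Fin R =>
                  orb (FermionTorus.ofTorusSite (a + fun i => ((u i : ℕ) : ZMod L))) 0)
                (fun u => ((φ j u : ℝ) : ℂ)) 0) *ᵥ ψ)).re)))) ^ 2) := by
  have hi0 : Function.Injective fun u : Fin 2 → Fin R =>
      orb (FermionTorus.ofTorusSite (a + fun i => ((u i : ℕ) : ZMod L))) 0 :=
    blockOrb_injective a hRL 0
  have hi1 : Function.Injective fun u : Fin 2 → Fin R =>
      orb (FermionTorus.ofTorusSite (a + fun i => ((u i : ℕ) : ZMod L))) 1 :=
    blockOrb_injective a hRL 1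
  have hdis : ∀ u v : Fin 2 → Fin R,
      (fun u : Fin 2 → Fin R =>
          orb (FermionTorus.ofTorusSite (a + fun i => ((u i : ℕ) : ZMod L))) 0) u ≠
        (fun u : Fin 2 → Fin R =>
          orb (FermionTorus.ofTorusSite (a + fun i => ((u i : ℕ) : ZMod L))) 1) v :=
    fun u v => orb_ne_of_spin_ne _ _
  -- the two inner parts are the same pair sum `Z`
  have hX := sum_smul_pair_eq hi0 hi1 φ (fun u v : Fin 2 → Fin R =>
    ∑ e ∈ insert (0 : Site 2) unitSteps,
      if (∀ i, ((v i : ℕ) : ℤ) = ((u i : ℕ) : ℤ) + e i) then dWaveFormFactor e / Real.sqrt 2 else 0)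
    κ hK
  have hK' : ∀ u v : Fin 2 → Fin R, (∑ e ∈ insert (0 : Site 2) unitSteps,
      if (∀ i, ((u i : ℕ) : ℤ) = ((v i : ℕ) : ℤ) + e i) then dWaveFormFactor e / Real.sqrt 2
      else 0) = ∑ j, κ j * (φ j u * φ j v) := fun u v => by
    rw [hK v u]
    exact Finset.sum_congr rfl fun j _ => by ring
  have hY := sum_smul_pair_eq hi0 hi1 φ (fun u v : Fin 2 → Fin R =>
    ∑ e ∈ insert (0 : Site 2) unitSteps,
      if (∀ i, ((u i : ℕ) : ℤ) = ((v i : ℕ) : ℤ) + e i) then dWaveFormFactor e / Real.sqrt 2 else 0)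
    κ hK'
  beta_reduce at hX hY
  have hsplit := blockPairOperator_split_raw (L := L) a R
  rw [sum_sum_smul_pair_sub_eq, hX, hY] at hsplit
  -- norms: `B_a ψ = Zψ + Zψ + ∂ψ`
  have hZ2 := re_star_sum_smul_pair_mulVec_le hi0 hi1 hdis φ hON κ κ₀ hκ ψ hψ
  rw [← norm_toLp_sq_eq_re] at hZ2
  have hψ1 : ‖(WithLp.toLp 2 ψ : EuclideanSpace ℂ (Finset (Orb (FermionTorus 2 L))))‖ = 1 := by
    have h := norm_toLp_sq_eq_re ψ
    rw [hψ, Complex.one_re] at h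
    exact (pow_eq_one_iff_of_nonneg (norm_nonneg _) two_ne_zero).1 h
  have hBd := norm_toLp_blockBoundary_mulVec_le a R ψ
  rw [hψ1, mul_one] at hBd
  rw [hsplit, ← norm_toLp_sq_eq_re, Matrix.add_mulVec, Matrix.add_mulVec, WithLp.toLp_add,
    WithLp.toLp_add]
  refine (norm_self_add_self_add_sq_le _ _ hZ2 hBd).trans (le_of_eq ?_)
  rw [mul_pow, Real.sq_sqrt zero_le_two]
  ring


/-- **Registered stub** (`stub_coarseBlockPairGramBound`, crux stmt-HubbardSuperconductivity-18534):
the block pair Gram bound with block-mode index set `[0,R)²`.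
Bardeen–Cooper–Schrieffer (1957) §II; Yang (1962) §3. [folklore] -/
theorem stub_coarseBlockPairGramBound :
    ∀ (L : ℕ) [NeZero L] (a : TorusSite 2 L) (R : ℕ), R ≤ L →
      ∀ (φ : (Fin 2 → Fin R) → (Fin 2 → Fin R) → ℝ),
        (∀ j j', ∑ u, φ j u * φ j' u = if j = j' then 1 else 0) →
        ∀ (κ : (Fin 2 → Fin R) → ℝ) (κ₀ : ℝ), (∀ j, |κ j| ≤ κ₀) →
        (∀ u v : Fin 2 → Fin R, (∑ e ∈ insert (0 : Site 2) unitSteps,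
            if (∀ i, ((v i : ℕ) : ℤ) = ((u i : ℕ) : ℤ) + e i) then dWaveFormFactor e / Real.sqrt 2
            else 0) = ∑ j, κ j * (φ j u * φ j v)) →
        ∀ (ψ : Fock (Orb (FermionTorus 2 L))), star ψ ⬝ᵥ ψ = 1 →
          (star ((∑ u : Fin 2 → Fin R,
              localPair dWaveFormFactor L (a + fun i => ((u i : ℕ) : ZMod L))) *ᵥ ψ) ⬝ᵥ
            ((∑ u : Fin 2 → Fin R,
              localPair dWaveFormFactor L (a + fun i => ((u i : ℕ) : ZMod L))) *ᵥ ψ)).re ≤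
          64 * (R : ℝ) ^ 2 + 8 * κ₀ ^ 2 *
            ((∑ j : Fin 2 → Fin R, (star ψ ⬝ᵥ (numberMode (Function.extend
                (fun u : Fin 2 → Fin R =>
                  orb (FermionTorus.ofTorusSite (a + fun i => ((u i : ℕ) : ZMod L))) 0)
                (fun u => ((φ j u : ℝ) : ℂ)) 0) *ᵥ ψ)).re) +
              (∑ j : Fin 2 → Fin R, Real.sqrt (Real.sqrt
                ((star ψ ⬝ᵥ (numberMode (Function.extend
                    (fun u : Fin 2 → Fin R =>
                      orb (FermionTorus.ofTorusSite (a + fun i => ((u i : ℕ) : ZMod L))) 0)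
                    (fun u => ((φ j u : ℝ) : ℂ)) 0) *ᵥ ψ)).re *
                  (1 - (star ψ ⬝ᵥ (numberMode (Function.extend
                    (fun u : Fin 2 → Fin R =>
                      orb (FermionTorus.ofTorusSite (a + fun i => ((u i : ℕ) : ZMod L))) 0)
                    (fun u => ((φ j u : ℝ) : ℂ)) 0) *ᵥ ψ)).re)))) ^ 2) :=
  fun _ _ a _ hRL φ hON κ κ₀ hκ hK ψ hψ => blockPairGram_bound a hRL φ hON κ κ₀ hκ hK ψ hψ

end Torus

end Summit.HubbardSuperconductivity.HubbardSuperconductivity.Theorems.CoarseTightness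

end
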